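import Literature.Analysis.Asymptotics.LaplaceMethodMultivariate
import HarnessLib

/-!
# The Laplace method with a non-degenerate MANIFOLD of minima (Morse–Bott ∕ parametrised form),
# in fibred coordinates `M × ℝ^m`

Topic `Literature/Analysis/Asymptotics`; sequel of `LaplaceMethodMultivariate.lean`
(`tendsto_laplaceMethod`: ONE non-degenerate minimum, `β^{d/2}∫e^{−β(S−S₀)}g → (2π)^{d/2}(det A)^{−1/2}g(x₀)`).
Everything here is PROVED; no definitions, no named facts.  Second half of the `ym-ir` request
«WANTED lit-4: Laplace's method … and its Morse–Bott form (non-degenerate MANIFOLD of minima)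
[Ellis–Rosen; Hwang, Ann. Probab. 8 (1980); Kirwin]» (LEAD `twisted-slab-continuity`, 2026-08-28).

THE STATEMENT FORMALISED (★★ `tendsto_laplaceMethod_fibred`).  `(M, ν)` an s-finite measure space (the
manifold of minima with its intrinsic measure — or any parameter space), `V` a finite-dimensional real
inner product space of dimension `m` with Lebesgue measure (the transversal directions), `S, g : M × V → ℝ`
measurable on the product, `A p : V →ₗ[ℝ] V` symmetric (transversal Hessians) with UNIFORM coercivity
`c‖y‖² ≤ ⟪A p y, y⟫`, a uniform second-order Peano expansion
`|S(p,y) − S₀ − ½⟪A p y, y⟫| ≤ ε‖y‖²` (`‖y‖ < δ(ε)`, all `p`; at `y = 0` it gives `S(p,0) = S₀`: the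
minimum value is attained on `M × {0}`), uniform separation `S(p,y) ≥ S₀ + η(δ) > S₀` for `‖y‖ ≥ δ`,
`g(p,·)` continuous at `0`, `|g(p,y)| ≤ G(p) ∈ L¹(ν)` for `‖y‖ < δ₁`, and `e^{−β₀S}g ∈ L¹(ν ⊗ dy)` for
one `β₀`.  THEN
`β^{m/2} ∫_{M×V} e^{−β(S−S₀)} g d(ν ⊗ dy) ⟶ (2π)^{m/2} ∫_M g(p,0) (det A p)^{−1/2} dν(p)`  (`β → ∞`).

This is the parametrised Laplace method at leading order — Hasenpflug–Rudolf–Sprungk's Theorem 16 /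
Remark 17 (after Korshunov), `c₀(θ) = (2π)^{s/2} g(t₀(θ),θ) det(∂²_t f(t₀(θ),θ))^{−1/2}` with the tail
condition `inf{f(t,θ) : ‖t − t₀(θ)‖ > ε, θ ∈ Θ} > 0` uniform in the parameter — INTEGRATED over the
parameter, which is the analytic content of Hwang's theorem on the weak limit of `e^{−nℓ}dμ₀/Z_n` when
the minimum set of `ℓ` is a manifold (limit density `∝ π₀(S_i(0,u))·det(∂²_t(ℓ∘S_i)(0,u))^{−1/2}` with
respect to the intrinsic measure, in tubular coordinates `S_i(t,u)`; HRS (3.1)/Assumption 3 (M)(T)(P)).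
Compactness of the parameter space is replaced by the uniformity of `δ(ε)`, `η(δ)`, `c`, and continuity
in the parameter by measurability + the `L¹` bound `G`.  What is NOT done here: the differential
topology (tubular neighbourhoods `N_i(ε)`, the diffeomorphisms `S_i`, the Jacobian normalisation) that
turns a Morse–Bott minimum set in `ℝ^d` or in a compact group into these fibred coordinates — a consumer
with coordinates `M × V` near its critical manifold (e.g. gauge orbit × transversal slice) applies the
theorem directly; the point case `M = pt` is `tendsto_laplaceMethod`.

Proof = the proof of `tendsto_laplaceMethod` run on the product measure: fibrewise substitution
`y ↦ y/√β` (`integral_comp_inv_sqrt_smul_snd`, via `Measure.map_prod_map` + `Measure.map_addHaar_smul`),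
domination on the window by `G(p)e^{−(c/4)‖y‖²}` (`Integrable.mul_prod`), pointwise limit
`e^{−½⟪A p y,y⟫}g(p,0)`, Lebesgue; window complement `≤ const·β^{m/2}e^{−ηβ}`; the limit integral by
Fubini and the anisotropic Gaussian integral fibre by fibre (`integral_exp_neg_half_inner_self'`).

HONEST FRAMING: classical real analysis; an input for «`β → ∞` at fixed box» ∕ semiclassical arguments
(cell `ym-ir`, row 43), width 0 by itself toward any lattice statement; the Yang–Mills mass gap (Clay)
is NOT touched; `R4` closes only `BalabanLadder.UV`.

## References
* M. Hasenpflug, D. Rudolf, B. Sprungk, *Wasserstein convergence rates of increasingly concentrating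
  probability measures*, Ann. Appl. Probab. 34 (2024) = arXiv:2207.08551, §3.1 Assumption 3 and the
  limit density `φ(u)`, App. 4.1 Theorem 16 / Remark 17 (parametrised Laplace method)
  (corpus `paper:arxiv-2207.08551` p0007, p0016). [HasenpflugRudolfSprungk2024]
* C.-R. Hwang, *Laplace's method revisited: weak convergence of probability measures*, Ann. Probab. 8
  (1980) 1177–1182 (held, scan without text layer; statement read through HRS 2024 §1, §3.1). [Hwang1980]
* K. W. Breitung, *Asymptotic Approximations for Probability Integrals*, LNM 1592 (1994), Thm 41 p. 56
  (the one-point proof reused fibrewise). [Breitung1994]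
-/

noncomputable section

open _root_.MeasureTheory _root_.Filter _root_.Set _root_.Module
open scoped _root_.Topology _root_.Real _root_.InnerProductSpace

namespace Literature.Analysis.Asymptotics

variable {M : Type*} [MeasurableSpace M] {ν : Measure M} [SFinite ν]
variable {V : Type*} [NormedAddCommGroup V] [InnerProductSpace ℝ V] [FiniteDimensional ℝ V]
  [MeasurableSpace V] [BorelSpace V]

/-- `(√β)^d = β^{d/2}`. [folklore] -/
private theorem sqrt_pow_eq_rpow' {β : ℝ} (hβ : 0 ≤ β) (d : ℕ) : Real.sqrt β ^ d = β ^ ((d : ℝ) / 2) := by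
  rw [Real.sqrt_eq_rpow, ← Real.rpow_natCast, ← Real.rpow_mul hβ]
  congr 1; ring

omit [FiniteDimensional ℝ V] [MeasurableSpace V] [BorelSpace V] in
/-- `⟪A (t • y), t • y⟫ = t² ⟪A y, y⟫`. [folklore] -/
private theorem inner_apply_smul_self' (A : V →ₗ[ℝ] V) (t : ℝ) (y : V) :
    ⟪A (t • y), t • y⟫_ℝ = t * t * ⟪A y, y⟫_ℝ := by
  rw [map_smul, real_inner_smul_left, real_inner_smul_right, mul_assoc]

/-- Fibrewise scaling of the product measure `ν ⊗ Lebesgue`: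
`∫_{M×V} f(p, y/√β) = (√β)^d ∫_{M×V} f` for measurable `f` and `β > 0` (the substitution (5.31) of
[Breitung1994, Thm 41] done in the transversal variables only). [cite: Breitung1994, Thm 41 proof (5.31) p. 57; Thm 49 proof (5.111)–(5.112) p. 71] -/
theorem integral_comp_inv_sqrt_smul_snd {f : M × V → ℝ} (hf : Measurable f) {β : ℝ} (hβ : 0 < β) :
    ∫ z, f (z.1, (Real.sqrt β)⁻¹ • z.2) ∂(ν.prod volume) =
      Real.sqrt β ^ finrank ℝ V * ∫ z, f z ∂(ν.prod volume) := by
  have hR : (Real.sqrt β)⁻¹ ≠ 0 := inv_ne_zero (Real.sqrt_pos.2 hβ).ne'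
  have hΨ : Measurable (fun z : M × V => (z.1, (Real.sqrt β)⁻¹ • z.2)) :=
    measurable_fst.prodMk (measurable_snd.const_smul _)
  have hmap : Measure.map (fun z : M × V => (z.1, (Real.sqrt β)⁻¹ • z.2)) (ν.prod volume) =
      ENNReal.ofReal (Real.sqrt β ^ finrank ℝ V) • (ν.prod volume) := by
    have h1 := Measure.map_prod_map ν (volume : Measure V) measurable_id
      (measurable_const_smul ((Real.sqrt β)⁻¹))
    rw [Measure.map_id, Measure.map_addHaar_smul volume hR, Measure.prod_smul_right] at h1
    rw [show (fun z : M × V => (z.1, (Real.sqrt β)⁻¹ • z.2)) =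
      Prod.map id (fun y : V => (Real.sqrt β)⁻¹ • y) from rfl, ← h1]
    congr 2
    rw [inv_pow, inv_inv, abs_of_nonneg (pow_nonneg (Real.sqrt_nonneg _) _)]
  have h2 := integral_map hΨ.aemeasurable (hf.aestronglyMeasurable (μ := Measure.map
    (fun z : M × V => (z.1, (Real.sqrt β)⁻¹ • z.2)) (ν.prod volume)))
  rw [← h2, hmap, integral_smul_measure, ENNReal.toReal_ofReal (by positivity), smul_eq_mul]

/-- **Laplace's method with a non-degenerate manifold of minima (Morse–Bott), in fibred coordinates.**
Let `(M, ν)` be an s-finite measure space (the manifold of minima with its volume measure, after the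
consumer's choice of tubular coordinates and Jacobian), `V` a finite-dimensional real inner product
space of dimension `m` (the transversal directions) with Lebesgue measure, and `S, g : M × V → ℝ`
measurable with

* a field of symmetric operators `A p` (transversal Hessians), UNIFORMLY coercive:
  `c‖y‖² ≤ ⟪A p y, y⟫` (`c > 0`);
* uniform second-order Peano expansion: `|S(p,y) − S₀ − ½⟪A p y, y⟫| ≤ ε‖y‖²` for `‖y‖ < δ(ε)`, all `p`
  (so `S(p,0) = S₀`: the minimum value `S₀` is attained on `M × {0}`);
* uniform separation: `S(p, y) ≥ S₀ + η(δ)` for `‖y‖ ≥ δ` (`η(δ) > 0`);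
* `g(p, ·)` continuous at `0` for every `p`, `|g(p, y)| ≤ G(p)` for `‖y‖ < δ₁` with `G ∈ L¹(ν)`;
* `e^{−β₀ S} g ∈ L¹(ν ⊗ Lebesgue)` for one `β₀`.

Then `β^{m/2} ∫_{M×V} e^{−β(S − S₀)} g d(ν ⊗ dy) ⟶ (2π)^{m/2} ∫_M g(p,0) (det A p)^{−1/2} dν(p)` as
`β → ∞` — the transversal Gaussian integral fibre by fibre: the parametrised Laplace method at leading
order (HRS Thm 16 / Remark 17, `c₀(θ) = (2π)^{s/2} g(t₀(θ),θ) det(∂²_t f)^{−1/2}`, tail condition uniform in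
`θ`) integrated over the parameter, i.e. the analytic content of Hwang's manifold-of-minima limit theorem
(limit density `∝ π₀ · det(∂²_t(ℓ∘S_i)(0,u))^{−1/2}` on `M_i`, HRS §3.1); the point case `M = pt` is
`tendsto_laplaceMethod`.  The tubular-neighbourhood step (coordinates `S_i(t,u)`, Jacobian) is NOT done
here: this is the analytic core for a consumer who already has coordinates `M × V` near the critical
manifold; uniformity in `p` replaces compactness of the parameter space.  Proof: the proof of
`tendsto_laplaceMethod` [Breitung1994 Thm 41] run on the product measure (fibrewise substitution
`y ↦ y/√β`, domination by `G(p)e^{−(c/4)‖y‖²}`, Lebesgue, Fubini for the limit).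
[cite: HasenpflugRudolfSprungk2024, App. 4.1 Thm 16 and Remark 17 (parametrised Laplace method, leading coefficient c₀(θ)); §3.1 Assumption 3 (T)(P) and the limit density φ(u)]
[cite: Hwang1980, main theorem (minimum set a manifold; weak limit with density ∝ det of the transversal Hessian^{−1/2})]
[cite: Breitung1994, Thm 41 p. 56 (one-point case; proof reused fibrewise)] -/
theorem tendsto_laplaceMethod_fibred {S g : M × V → ℝ} {S₀ : ℝ} {A : M → V →ₗ[ℝ] V} {c : ℝ}
    (hA : ∀ p, (A p).IsSymmetric) (hc : 0 < c) (hcoer : ∀ p y, c * ‖y‖ ^ 2 ≤ ⟪A p y, y⟫_ℝ)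
    (hSm : Measurable S) (hgm : Measurable g)
    (hS2 : ∀ ε : ℝ, 0 < ε → ∃ δ : ℝ, 0 < δ ∧ ∀ p y, ‖y‖ < δ →
      |S (p, y) - S₀ - (1 / 2) * ⟪A p y, y⟫_ℝ| ≤ ε * ‖y‖ ^ 2)
    (hsep : ∀ δ : ℝ, 0 < δ → ∃ η : ℝ, 0 < η ∧ ∀ p y, δ ≤ ‖y‖ → S₀ + η ≤ S (p, y))
    (hg : ∀ p, ContinuousAt (fun y => g (p, y)) 0)
    {G : M → ℝ} (hG : Integrable G ν) {δ₁ : ℝ} (hδ₁ : 0 < δ₁) (hgG : ∀ p y, ‖y‖ < δ₁ → |g (p, y)| ≤ G p)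
    {β₀ : ℝ} (hint : Integrable (fun z => Real.exp (-β₀ * S z) * g z) (ν.prod volume)) :
    Tendsto (fun β : ℝ => β ^ ((finrank ℝ V : ℝ) / 2) *
        ∫ z, Real.exp (-β * (S z - S₀)) * g z ∂(ν.prod volume)) atTop
      (𝓝 ((2 * π) ^ ((finrank ℝ V : ℝ) / 2) * ∫ p, g (p, 0) / Real.sqrt (LinearMap.det (A p)) ∂ν)) := by
  set d := finrank ℝ V with hd
  set μ : Measure (M × V) := ν.prod volume with hμ
  have hpos : ∀ p (y : V), y ≠ 0 → 0 < ⟪A p y, y⟫_ℝ := fun p y hy =>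
    lt_of_lt_of_le (by positivity) (hcoer p y)
  set r : M × V → ℝ := fun z => S z - S₀ - (1 / 2) * ⟪A z.1 z.2, z.2⟫_ℝ with hr
  -- (a) the window `δ`
  have hc4 : 0 < c / 4 := by positivity
  obtain ⟨δ₂, hδ₂, hT⟩ := hS2 (c / 4) hc4
  set δ := min δ₁ δ₂ with hδdef
  have hδ : 0 < δ := lt_min hδ₁ hδ₂
  have hlow : ∀ p y, ‖y‖ < δ → c / 4 * ‖y‖ ^ 2 ≤ S (p, y) - S₀ := by
    intro p y hy
    have h1 := hT p y (lt_of_lt_of_le hy (min_le_right _ _))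
    have h2 := hcoer p y
    have h4 := neg_abs_le (S (p, y) - S₀ - (1 / 2) * ⟪A p y, y⟫_ℝ)
    nlinarith
  obtain ⟨η, hη, hsepδ⟩ := hsep δ hδ
  have hSge : ∀ z : M × V, S₀ ≤ S z := by
    rintro ⟨p, y⟩
    rcases lt_or_ge ‖y‖ δ with h | h
    · have h1 := hlow p y h
      have h2 : 0 ≤ c / 4 * ‖y‖ ^ 2 := by positivity
      linarith
    · linarith [hsepδ p y h]
  -- the window set
  set B : Set (M × V) := {z | ‖z.2‖ < δ} with hB
  have hBm : MeasurableSet B := by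
    have : B = Prod.snd ⁻¹' Metric.ball (0 : V) δ := by
      ext z; simp [hB, Metric.mem_ball, dist_zero_right]
    rw [this]
    exact measurable_snd Metric.isOpen_ball.measurableSet
  -- the integrand and the integrable weight
  set F : ℝ → M × V → ℝ := fun β z => Real.exp (-β * (S z - S₀)) * g z with hF
  have hFm : ∀ β, Measurable (F β) := fun β =>
    (Real.measurable_exp.comp ((hSm.sub measurable_const).const_mul _)).mul hgm
  set K : M × V → ℝ := fun z => Real.exp (-β₀ * (S z - S₀)) * |g z| with hK
  have hKint : Integrable K μ := by
    have hKeq : K = fun z => Real.exp (β₀ * S₀) * |Real.exp (-β₀ * S z) * g z| := by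
      funext z
      simp only [hK]
      rw [abs_mul, abs_of_pos (Real.exp_pos _), show -β₀ * (S z - S₀) = β₀ * S₀ + -β₀ * S z by ring,
        Real.exp_add]
      ring
    rw [hKeq]
    exact hint.abs.const_mul _
  have hKnn : ∀ z, 0 ≤ K z := fun z => by positivity
  have hFK : ∀ β, β₀ ≤ β → ∀ z, |F β z| ≤ K z := by
    intro β hβ z
    simp only [hF, hK, abs_mul, abs_of_pos (Real.exp_pos _)]
    refine mul_le_mul_of_nonneg_right ?_ (abs_nonneg _)
    rw [Real.exp_le_exp]
    have := hSge z
    nlinarith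
  have hFint : ∀ β, β₀ ≤ β → Integrable (F β) μ := fun β hβ =>
    Integrable.mono' hKint (hFm β).aestronglyMeasurable
      (Eventually.of_forall fun z => by rw [Real.norm_eq_abs]; exact hFK β hβ z)
  have hFtail : ∀ β, β₀ ≤ β → ∀ z, z ∉ B → |F β z| ≤ Real.exp (-(β - β₀) * η) * K z := by
    rintro β hβ ⟨p, y⟩ hz
    have hy : δ ≤ ‖y‖ := by
      by_contra h
      exact hz (by simp [hB, not_le.1 h])
    have hSz := hsepδ p y hy
    simp only [hF, hK, abs_mul, abs_of_pos (Real.exp_pos _)]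
    rw [← mul_assoc, ← Real.exp_add]
    refine mul_le_mul_of_nonneg_right ?_ (abs_nonneg _)
    rw [Real.exp_le_exp]
    have h1 : 0 ≤ (β - β₀) * (S (p, y) - S₀ - η) := mul_nonneg (sub_nonneg.2 hβ) (by linarith)
    nlinarith
  -- (b) the split
  have hsplit : ∀ β, β₀ ≤ β → 0 < β →
      β ^ ((d : ℝ) / 2) * ∫ z, F β z ∂μ =
        (∫ z, B.indicator (F β) (z.1, (Real.sqrt β)⁻¹ • z.2) ∂μ) +
          β ^ ((d : ℝ) / 2) * ∫ z, Bᶜ.indicator (F β) z ∂μ := by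
    intro β hβ hβpos
    have h1 : ∫ z, F β z ∂μ = (∫ z, B.indicator (F β) z ∂μ) + ∫ z, Bᶜ.indicator (F β) z ∂μ := by
      rw [integral_indicator hBm, integral_indicator hBm.compl, integral_add_compl hBm (hFint β hβ)]
    have h2 : ∫ z, B.indicator (F β) (z.1, (Real.sqrt β)⁻¹ • z.2) ∂μ =
        β ^ ((d : ℝ) / 2) * ∫ z, B.indicator (F β) z ∂μ := by
      rw [hμ, integral_comp_inv_sqrt_smul_snd ((hFm β).indicator hBm) hβpos, sqrt_pow_eq_rpow' hβpos.le]
    rw [h1, mul_add, h2]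
  -- (c) the complement of the window is negligible
  have htail : Tendsto (fun β : ℝ => β ^ ((d : ℝ) / 2) * ∫ z, Bᶜ.indicator (F β) z ∂μ) atTop (𝓝 0) := by
    have hKI : 0 ≤ ∫ z, K z ∂μ := integral_nonneg hKnn
    have hlim : Tendsto (fun β : ℝ => Real.exp (β₀ * η) * (∫ z, K z ∂μ) *
        (β ^ ((d : ℝ) / 2) * Real.exp (-η * β))) atTop (𝓝 0) := by
      have := (tendsto_rpow_mul_exp_neg_mul_atTop_nhds_zero ((d : ℝ) / 2) η hη).const_mul
        (Real.exp (β₀ * η) * ∫ z, K z ∂μ)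
      simpa using this
    refine squeeze_zero_norm' ?_ hlim
    filter_upwards [eventually_ge_atTop β₀, eventually_gt_atTop 0] with β hβ hβpos
    rw [Real.norm_eq_abs, abs_mul, abs_of_nonneg (by positivity : 0 ≤ β ^ ((d : ℝ) / 2))]
    have hI : |∫ z, Bᶜ.indicator (F β) z ∂μ| ≤ Real.exp (-(β - β₀) * η) * ∫ z, K z ∂μ := by
      calc |∫ z, Bᶜ.indicator (F β) z ∂μ| ≤ ∫ z, |Bᶜ.indicator (F β) z| ∂μ := abs_integral_le_integral_abs
        _ ≤ ∫ z, Real.exp (-(β - β₀) * η) * K z ∂μ := by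
            refine integral_mono_of_nonneg (Eventually.of_forall fun z => abs_nonneg _) (hKint.const_mul _)
              (Eventually.of_forall fun z => ?_)
            by_cases hz : z ∈ B
            · have hz' : z ∉ Bᶜ := fun h => h hz
              simp only [Set.indicator_of_notMem hz', abs_zero]
              exact mul_nonneg (Real.exp_pos _).le (hKnn z)
            · simp only [Set.indicator_of_mem (Set.mem_compl hz)]
              exact hFtail β hβ z hz
        _ = Real.exp (-(β - β₀) * η) * ∫ z, K z ∂μ := integral_const_mul _ _
    calc β ^ ((d : ℝ) / 2) * |∫ z, Bᶜ.indicator (F β) z ∂μ|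
        ≤ β ^ ((d : ℝ) / 2) * (Real.exp (-(β - β₀) * η) * ∫ z, K z ∂μ) := by gcongr
      _ = Real.exp (β₀ * η) * (∫ z, K z ∂μ) * (β ^ ((d : ℝ) / 2) * Real.exp (-η * β)) := by
          rw [show -(β - β₀) * η = β₀ * η + -η * β by ring, Real.exp_add]; ring
  -- (d) dominated convergence on the rescaled window, on the product
  set Φ : ℝ → M × V → ℝ := fun β z => B.indicator (F β) (z.1, (Real.sqrt β)⁻¹ • z.2) with hΦ
  set f : M × V → ℝ := fun z => Real.exp (-(1 / 2) * ⟪A z.1 z.2, z.2⟫_ℝ) * g (z.1, 0) with hf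
  have hΦm : ∀ β, Measurable (Φ β) := fun β =>
    ((hFm β).indicator hBm).comp (measurable_fst.prodMk (measurable_snd.const_smul _))
  have hbound_int : Integrable (fun z : M × V => G z.1 * Real.exp (-(c / 4) * ‖z.2‖ ^ 2)) μ :=
    hG.mul_prod (integrable_exp_neg_mul_norm_sq hc4)
  have hΦle : ∀ β, 0 < β → ∀ z, |Φ β z| ≤ G z.1 * Real.exp (-(c / 4) * ‖z.2‖ ^ 2) := by
    rintro β hβpos ⟨p, y⟩
    simp only [hΦ]
    set x : M × V := (p, (Real.sqrt β)⁻¹ • y) with hx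
    have hGp : 0 ≤ G p := (abs_nonneg _).trans (hgG p 0 (by simpa using hδ₁))
    by_cases hxB : x ∈ B
    · rw [Set.indicator_of_mem hxB]
      have hxn : ‖(Real.sqrt β)⁻¹ • y‖ < δ := by simpa [hB, hx] using hxB
      have hxy : ‖(Real.sqrt β)⁻¹ • y‖ ^ 2 = ‖y‖ ^ 2 / β := by
        rw [norm_smul, norm_inv, Real.norm_eq_abs, abs_of_nonneg (Real.sqrt_nonneg _), mul_pow, inv_pow,
          Real.sq_sqrt hβpos.le]
        ring
      simp only [hF, abs_mul, abs_of_pos (Real.exp_pos _)]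
      rw [mul_comm (G p)]
      have hle1 : Real.exp (-β * (S x - S₀)) ≤ Real.exp (-(c / 4) * ‖y‖ ^ 2) := by
        rw [Real.exp_le_exp]
        have h1 := hlow p _ hxn
        rw [hxy] at h1
        have h2 : β * (c / 4 * (‖y‖ ^ 2 / β)) = c / 4 * ‖y‖ ^ 2 := by field_simp
        have h3 := mul_le_mul_of_nonneg_left h1 hβpos.le
        rw [h2] at h3
        linarith
      have hle2 : |g x| ≤ G p := hgG p _ (lt_of_lt_of_le hxn (min_le_left _ _))
      exact mul_le_mul hle1 hle2 (abs_nonneg _) (Real.exp_pos _).le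
    · rw [Set.indicator_of_notMem hxB, abs_zero]
      positivity
  have hΦlim : ∀ z, Tendsto (fun β => Φ β z) atTop (𝓝 (f z)) := by
    rintro ⟨p, y⟩
    -- the rescaled transversal point tends to `0`
    have hh : Tendsto (fun β : ℝ => (Real.sqrt β)⁻¹ • y) atTop (𝓝 0) := by
      have h1 : Tendsto (fun β : ℝ => (Real.sqrt β)⁻¹) atTop (𝓝 0) :=
        tendsto_inv_atTop_zero.comp Real.tendsto_sqrt_atTop
      simpa using h1.smul_const y
    have hgx : Tendsto (fun β : ℝ => g (p, (Real.sqrt β)⁻¹ • y)) atTop (𝓝 (g (p, 0))) :=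
      (hg p).tendsto.comp hh
    -- the fibre remainder is `o(‖y‖²)` at `0`
    set rp : V → ℝ := fun y => S (p, y) - S₀ - (1 / 2) * ⟪A p y, y⟫_ℝ with hrp
    have hrpo : rp =o[𝓝 (0 : V)] fun y => ‖y - 0‖ ^ 2 := by
      refine Asymptotics.isLittleO_iff.2 fun ε hε => ?_
      obtain ⟨δ', hδ', h⟩ := hS2 ε hε
      filter_upwards [Metric.ball_mem_nhds (0 : V) hδ'] with w hw
      rw [Metric.mem_ball, dist_zero_right] at hw
      rw [sub_zero, Real.norm_eq_abs, Real.norm_eq_abs, abs_of_nonneg (by positivity : (0 : ℝ) ≤ ‖w‖ ^ 2)]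
      exact h p w hw
    have hrem : Tendsto (fun β : ℝ => β * rp ((0 : V) + (Real.sqrt β)⁻¹ • y)) atTop (𝓝 0) :=
      tendsto_mul_remainder_inv_sqrt hrpo y
    simp only [zero_add] at hrem
    have hexp : Tendsto (fun β : ℝ => Real.exp (-((1 / 2) * ⟪A p y, y⟫_ℝ + β * rp ((Real.sqrt β)⁻¹ • y))))
        atTop (𝓝 (Real.exp (-((1 / 2) * ⟪A p y, y⟫_ℝ)))) := by
      have h1 := (tendsto_const_nhds (x := (1 / 2) * ⟪A p y, y⟫_ℝ)).add hrem
      rw [add_zero] at h1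
      exact (Real.continuous_exp.tendsto _).comp h1.neg
    have hprod := hexp.mul hgx
    rw [show -((1 / 2) * ⟪A p y, y⟫_ℝ) = -(1 / 2) * ⟪A p y, y⟫_ℝ by ring] at hprod
    refine hprod.congr' ?_
    have hevB : ∀ᶠ β : ℝ in atTop, ((p, (Real.sqrt β)⁻¹ • y) : M × V) ∈ B := by
      have h1 : ∀ᶠ β : ℝ in atTop, (Real.sqrt β)⁻¹ • y ∈ Metric.ball (0 : V) δ :=
        hh (Metric.isOpen_ball.mem_nhds (Metric.mem_ball_self hδ))
      filter_upwards [h1] with β hβ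
      simpa [hB, Metric.mem_ball, dist_zero_right] using hβ
    filter_upwards [hevB, eventually_gt_atTop 0] with β hβB hβpos
    simp only [hΦ]
    rw [Set.indicator_of_mem hβB]
    simp only [hF]
    congr 2
    have hrx : S (p, (Real.sqrt β)⁻¹ • y) - S₀ =
        (1 / 2) * ⟪A p ((Real.sqrt β)⁻¹ • y), (Real.sqrt β)⁻¹ • y⟫_ℝ + rp ((Real.sqrt β)⁻¹ • y) := by
      simp only [hrp]; ring
    have hsq : β * ((Real.sqrt β)⁻¹ * (Real.sqrt β)⁻¹) = 1 := by
      rw [← mul_inv, Real.mul_self_sqrt hβpos.le, mul_inv_cancel₀ hβpos.ne']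
    rw [hrx, inner_apply_smul_self']
    calc -((1 / 2) * ⟪A p y, y⟫_ℝ + β * rp ((Real.sqrt β)⁻¹ • y))
        = -((1 / 2) * (β * ((Real.sqrt β)⁻¹ * (Real.sqrt β)⁻¹)) * ⟪A p y, y⟫_ℝ +
            β * rp ((Real.sqrt β)⁻¹ • y)) := by rw [hsq, mul_one]
      _ = -β * ((1 / 2) * ((Real.sqrt β)⁻¹ * (Real.sqrt β)⁻¹ * ⟪A p y, y⟫_ℝ) + rp ((Real.sqrt β)⁻¹ • y)) := by
          ring
  have hinner : Tendsto (fun β => ∫ z, Φ β z ∂μ) atTop (𝓝 (∫ z, f z ∂μ)) := by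
    refine tendsto_integral_filter_of_dominated_convergence
      (fun z : M × V => G z.1 * Real.exp (-(c / 4) * ‖z.2‖ ^ 2)) ?_ ?_ hbound_int
      (Eventually.of_forall hΦlim)
    · exact Eventually.of_forall fun β => (hΦm β).aestronglyMeasurable
    · filter_upwards [eventually_gt_atTop 0] with β hβpos
      exact Eventually.of_forall fun z => by rw [Real.norm_eq_abs]; exact hΦle β hβpos z
  -- (e) the limit integral, by Fubini and the anisotropic Gaussian integral fibre by fibre
  have hfm : AEStronglyMeasurable f μ :=
    aestronglyMeasurable_of_tendsto_ae atTop (fun β => (hΦm β).aestronglyMeasurable)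
      (Eventually.of_forall hΦlim)
  have hfle : ∀ z, |f z| ≤ G z.1 * Real.exp (-(c / 4) * ‖z.2‖ ^ 2) := by
    rintro ⟨p, y⟩
    simp only [hf, abs_mul, abs_of_pos (Real.exp_pos _)]
    rw [mul_comm (G p)]
    refine mul_le_mul ?_ (hgG p 0 (by simpa using hδ₁)) (abs_nonneg _) (Real.exp_pos _).le
    rw [Real.exp_le_exp]
    have := hcoer p y
    nlinarith [sq_nonneg ‖y‖, hc]
  have hfint : Integrable f μ :=
    Integrable.mono' hbound_int hfm (Eventually.of_forall fun z => by rw [Real.norm_eq_abs]; exact hfle z)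
  have hlimval : ∫ z, f z ∂μ = (2 * π) ^ ((d : ℝ) / 2) * ∫ p, g (p, 0) / Real.sqrt (LinearMap.det (A p)) ∂ν := by
    rw [hμ, integral_prod f hfint, ← integral_const_mul]
    refine integral_congr_ae (ae_of_all _ fun p => ?_)
    simp only [hf]
    rw [integral_mul_const, integral_exp_neg_half_inner_self' (hA p) (hpos p)]
    ring
  -- (f) assemble
  have hsum := hinner.add htail
  rw [add_zero, hlimval] at hsum
  refine hsum.congr' ?_
  filter_upwards [eventually_ge_atTop β₀, eventually_gt_atTop 0] with β hβ hβpos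
  exact (hsplit β hβ hβpos).symm

end Literature.Analysis.Asymptotics
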